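import Summits.QuantumFields.YangMills.Theorems.BalabanUVNodesPortU8LocUnivLapKernelRow
import Summits.QuantumFields.YangMills.Theorems.BalabanUVNodesPortU8LocUnivPackageClause3

/-!
# Port piece U8 — ★★★ THE LAPLACIAN CLAUSE OF (‴-LocUniv), PROVED: `norm_recordHrLocξ_univ_lapStencil_le`
# `‖Σ_ν [Hr(x+e_ν,μ) − 2·Hr(x,μ) + Hr(x−e_ν,μ)]‖ ≤ C₃·η³·e^{−δ₃·tdist(coarsenTo (k+1) x, y)}` for `Hr = recordHrLocξ F θ k K univ a (μ,y)`, with `C₃ ≥ 0`, `δ₃ > 0` depending on the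
# family `F` only — clause 3 of the displayed token at the letter; hence ★★★ `portPieceLocalityU8_LocUniv_of_cmp`: the selector-free U8 package with ALL FOUR (‴-LocUniv) clauses
# discharged, displayed input (Tok-cmpU-cap) ONLY

Cell `ym-nodeO-ideate` ∕ `ym-balaban-port`, porter `ymgap-nodeO-port-PTB-1` (gen 5).  JOIN-side helper for **stmt-QuantumFields-27238** (K0ᴬ), `--supports … --as helper`.
[15] = [Balaban1985Variational], [B5] = [Balaban1984PropagatorsI], [B6] = [Balaban1984PropagatorsII], [I] = [Balaban1987RG1].

WHAT IS PROVED (kernel, sorry-free).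
§1 `lapStencil_recordHrLocξ_eq_smul` — the colour wrapper commutes with the Laplacian stencil: for `Hr = recordHrLocξ … univ a (μ,y)` (`= η·windowResp·ρ₈(bV a)` entrywise) the matrix
   stencil `Σ_ν [Hr(b+e_ν) − 2•Hr(b) + Hr(b−e_ν)]` is `(η·Σ_ν [W(b+e_ν) − 2W(b) + W(b−e_ν)]) • ρ₈(bV a)`, `W = windowResp univ (μ,y)`.
§2 ★★★ `norm_recordHrLocξ_univ_lapStencil_le` — CLAUSE 3: `∃ C₃ ≥ 0, δ₃ > 0` (from step 1's ✓`abs_lapStencil_windowResp_univ_le`, `δ₃ = δ∕4`) with the displayed bound for all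
   `a₀ ε₂₉ K k` (`k + 2 ≤ m + K`) `a μ y b` — ✓ Laplacian kernel row (η²) × `η` (chart units) × `‖ρ₈(bV a)‖ ≤ 1` (✓`thetaFill_norm_ρ8_bV_le_one`) and the distance dictionary
   ✓`tdist_le_mul_torusSupNorm`.
§3 ★★ `h3_recordHrLocξ_univ` — the displayed clause-3 hypothesis `h3` of ✓`portPieceLocalityU8_LocUniv_of_clause3`, INHABITED at the port's volumes `K = recordK₀ F Mc k + n` (✓`hk2_recordK₀`).
§4 ★★★ `portPieceLocalityU8_LocUniv_of_cmp` — the selector-free U8 package (C1)ᵀ + (C2a)(C2b)ᵀ + (E4a)ᵀ of ✓`portPieceLocalityU8_LocUniv` with displayed input (Tok-cmpU-cap) ONLY: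
   all four (190)-clauses of (‴-LocUniv) for `recordHrLocξ … Finset.univ` are now tree theorems (clause 1 ✓p813673, clause 2 ✓p813794, clause 4 ✓p816287, clause 3 here).

HONEST FRAMING.  Bookkeeping over PROVED tree theorems (p22∕r03's [B6] Sect. C two-scale layer and its [B5] Prop. 1.2 input; DEF-1∕PTZ-1's window currency); the token (‴-LocUniv) —
the four [15] (190)-type clauses for the SELECTOR-FREE whole-torus response at the flat background — is met by tree theorems IN FULL; (Tok-cmpU-cap) (the window-vs-whole-torus
comparison, [I] (1.21)-type) remains DISPLAYED and is the ONLY displayed input of the package; (C-tab-opt), JOIN-T untouched; nothing of Bałaban's renormalization-group analysis at the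
record asserted; 27931 CLOSED·IMPLICATION-ONLY·IN TOTO unchanged; K0ᴬ 27238 OPEN; NODE O 0∕1; COUNT 8∕28 · K 1∕4 UNMOVED; finite `𝕋⁴_{L^K}` at fixed ε — NOT continuum ∕ OS ∕ Clay;
**the Yang–Mills mass gap (Clay) is NOT proved by any of this.**
-/

noncomputable section

open scoped BigOperators

namespace Summit.QuantumFields.YangMills.Theorems.PortU8

open Literature.MathematicalPhysics.QuantumFieldTheory.Balaban1983to89
open Literature.MathematicalPhysics.QuantumFieldTheory.Balaban1983to89.Node00
open Literature.MathematicalPhysics.QuantumFieldTheory.Balaban1983to89.T4Continuum (T4Family)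
open Literature.MathematicalPhysics.QuantumFieldTheory.Balaban1983to89.B5Eq117TorusCarriers (Mk)
open Literature.MathematicalPhysics.QuantumFieldTheory.Balaban1983to89.B5Eq118OneStroke (iterBlockOf)
open Literature.MathematicalPhysics.QuantumFieldTheory.Balaban1983to89.B4TorusKernel.MultiPeriod (torusSupNorm)
open Literature.MathematicalPhysics.QuantumFieldTheory.Balaban1983to89.B6LowerBound2153Torus (rep)
open Summit.QuantumFields.YangMills.Theorems.K0RecordFormatNames

variable (F : T4Family)

/-! ## §1  The colour wrapper commutes with the Laplacian stencil -/

/-- **THE MATRIX LAPLACIAN STENCIL FACTORS**: for `Hr = recordHrLocξ F θ k K univ a (μ, y)` (`= η·windowResp·ρ₈(bV a)` entrywise) the token's Laplacian stencil is the scalar stencil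
times the fixed colour matrix: `Σ_ν [Hr(b+e_ν) − 2•Hr(b) + Hr(b−e_ν)] = (η·Σ_ν [W(b+e_ν) − 2W(b) + W(b−e_ν)]) • ρ₈(bV a)`, `W = windowResp univ (μ,y)`.
[cite: Balaban1987RG1, (3.37) p.277, (4.35) p.290 (bookkeeping); Balaban1984PropagatorsI, (1.21) p.21] -/
theorem lapStencil_recordHrLocξ_eq_smul (a₀ ε₂₉ : ℝ) (k K : ℕ) (a : (thetaFill F a₀ ε₂₉).ιβ) (μ : Fin (F.P K).d) (y : Site (F.P K) (k + 1))
    (b : PBond (F.P K) 0) :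
    letI θ := thetaFill F a₀ ε₂₉; letI := θ.instVβ₁; letI := θ.instVβ₂; letI := θ.instιβ
    letI Hr : PBond (F.P K) 0 → Fin 2 → Fin 2 → ℂ := fun b' => recordHrLocξ F θ k K Finset.univ a (μ, y) b'
    (∑ ν : Fin (F.P K).d, (Hr ⟨b.src.shift ν, b.dir⟩ - (2 : ℂ) • Hr b + Hr ⟨b.src.unshift ν, b.dir⟩)) =
      ((((F.P K).eta (k + 1) * ∑ ν : Fin (F.P K).d, (windowResp F k K Finset.univ (μ, y) ⟨b.src.shift ν, b.dir⟩ -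
          2 * windowResp F k K Finset.univ (μ, y) b + windowResp F k K Finset.univ (μ, y) ⟨b.src.unshift ν, b.dir⟩) : ℝ) : ℂ)) •
        (fun i i' : Fin 2 => θ.ρ8 (θ.bV a) i i') := by
  letI θ := thetaFill F a₀ ε₂₉; letI := θ.instVβ₁; letI := θ.instVβ₂; letI := θ.instιβ
  funext i i'
  simp only [Finset.sum_apply, Pi.sub_apply, Pi.add_apply, Pi.smul_apply, smul_eq_mul, recordHrLocξ, windowRespξ,
    Complex.ofReal_mul, Complex.ofReal_sum, Finset.mul_sum, Finset.sum_mul]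
  refine Finset.sum_congr rfl fun ν _ => ?_
  push_cast
  ring

/-! ## §2  ★★★ Clause 3 of (‴-LocUniv) -/

/-- ★★★ **THE LAPLACIAN CLAUSE OF (‴-LocUniv), PROVED**: there are `C₃ ≥ 0`, `δ₃ > 0` depending on the family `F` only such that for all `a₀ ε₂₉`, every volume `K` and level `k`
with one spare level (`k + 2 ≤ m + K`), colour `a`, label `(μ, y)` and fine bond `b`, the token's Laplacian stencil of `Hr = recordHrLocξ F θ k K univ a (μ, y)` has sup-entry norm
`≤ C₃·η³·e^{−δ₃·tdist(coarsenTo (k+1) b₋, y)}`, `η = eta (k+1)` — step 1's Laplacian kernel row (p22's [B6] (2.130)∕Prop. 2.5 row at `d + 1 = 4`), the chart-unit factor `η`, `‖ρ₈(bV a)‖ ≤ 1`.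
[cite: Balaban1985Variational, (190) p.308; Balaban1984PropagatorsII, (2.130) p.246, Prop. 2.5 p.246; Balaban1984PropagatorsI, Prop. 1.2 (1.110) p.35; Balaban1987RG1, (4.35) p.290] -/
theorem norm_recordHrLocξ_univ_lapStencil_le :
    ∃ C₃ δ₃ : ℝ, 0 ≤ C₃ ∧ 0 < δ₃ ∧ ∀ (a₀ ε₂₉ : ℝ) (K k : ℕ) (_hk2 : k + 1 + 1 ≤ (F.P K).m + (F.P K).K),
      letI θ := thetaFill F a₀ ε₂₉; letI := θ.instVβ₁; letI := θ.instVβ₂; letI := θ.instιβ;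
      ∀ (a : θ.ιβ) (μ : Fin (F.P K).d) (y : Site (F.P K) (k + 1)),
      letI Hr : PBond (F.P K) 0 → Fin 2 → Fin 2 → ℂ := fun b' => recordHrLocξ F θ k K Finset.univ a (μ, y) b';
      ∀ b : PBond (F.P K) 0,
        ‖∑ ν : Fin (F.P K).d, (Hr ⟨b.src.shift ν, b.dir⟩ - (2 : ℂ) • Hr b + Hr ⟨b.src.unshift ν, b.dir⟩)‖ ≤
          C₃ * (F.P K).eta (k + 1) ^ 3 * Real.exp (-(δ₃ * (Site.tdist (coarsenTo (k + 1) b.src) y : ℝ))) := by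
  obtain ⟨δ, hδ, C, hC, hrow⟩ := abs_lapStencil_windowResp_univ_le F
  refine ⟨C, δ / 4, hC, by positivity, fun a₀ ε₂₉ K k hk2 a μ y b => ?_⟩
  letI θ := thetaFill F a₀ ε₂₉; letI := θ.instVβ₁; letI := θ.instVβ₂; letI := θ.instιβ
  have hη0 : 0 ≤ (F.P K).eta (k + 1) := by unfold Params.eta; exact (pow_pos (inv_pos.2 (F.P K).cast_L_pos) _).le
  have hR0 : 0 ≤ ‖fun i i' : Fin 2 => θ.ρ8 (θ.bV a) i i'‖ := norm_nonneg _
  have hR1 : ‖fun i i' : Fin 2 => θ.ρ8 (θ.bV a) i i'‖ ≤ 1 := thetaFill_norm_ρ8_bV_le_one F a₀ ε₂₉ a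
  have hS := hrow K k hk2 (μ, y) b
  have hdist := tdist_le_mul_torusSupNorm F (coarsenTo (k + 1) b.src) y
  have hexp : Real.exp (-(δ * torusSupNorm (Mk (F.P K) (k + 1)) (rep (Mk (F.P K) (k + 1)) (iterBlockOf (k + 1) b.src) - rep (Mk (F.P K) (k + 1)) y))) ≤
      Real.exp (-(δ / 4 * (Site.tdist (coarsenTo (k + 1) b.src) y : ℝ))) := by
    refine Real.exp_le_exp.2 (neg_le_neg ?_)
    rw [← coarsenTo_eq_iterBlockOf]
    have := mul_le_mul_of_nonneg_left hdist hδ.le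
    linarith
  rw [lapStencil_recordHrLocξ_eq_smul F a₀ ε₂₉ k K a μ y b, norm_smul, Complex.norm_real, Real.norm_eq_abs, abs_mul, abs_of_nonneg hη0]
  calc (F.P K).eta (k + 1) * |∑ ν : Fin (F.P K).d, (windowResp F k K Finset.univ (μ, y) ⟨b.src.shift ν, b.dir⟩ -
          2 * windowResp F k K Finset.univ (μ, y) b + windowResp F k K Finset.univ (μ, y) ⟨b.src.unshift ν, b.dir⟩)| *
        ‖fun i i' : Fin 2 => θ.ρ8 (θ.bV a) i i'‖
      ≤ (F.P K).eta (k + 1) * (C * (F.P K).eta (k + 1) ^ 2 * Real.exp (-(δ / 4 * (Site.tdist (coarsenTo (k + 1) b.src) y : ℝ)))) * 1 := by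
        refine mul_le_mul (mul_le_mul_of_nonneg_left (hS.trans ?_) hη0) hR1 hR0 (mul_nonneg hη0 (by positivity))
        exact mul_le_mul_of_nonneg_left hexp (by positivity)
    _ = C * (F.P K).eta (k + 1) ^ 3 * Real.exp (-(δ / 4 * (Site.tdist (coarsenTo (k + 1) b.src) y : ℝ))) := by ring

/-! ## §3  The displayed clause-3 hypothesis at the port's volumes -/

/-- ★★ **THE DISPLAYED CLAUSE-3 HYPOTHESIS `h3` OF ✓`portPieceLocalityU8_LocUniv_of_clause3`, INHABITED** at the port's volumes `K = recordK₀ F Mc k + n` (one spare level by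
✓`hk2_recordK₀`). [cite: Balaban1985Variational, (190) p.308; Balaban1984PropagatorsII, Prop. 2.5 p.246; Balaban1987RG1, (4.35) p.290] -/
theorem h3_recordHrLocξ_univ (Mc : ℕ) (a₀ : ℝ) :
    ∃ C₉' δ₉ : ℝ, 0 ≤ C₉' ∧ 0 < δ₉ ∧ ∀ (k n : ℕ) (ε₂₉ : ℝ), 0 < ε₂₉ → letI θ := thetaFill F a₀ ε₂₉; letI := θ.instVβ₁; letI := θ.instVβ₂; letI := θ.instιβ;
      ∀ (a : θ.ιβ) (μ : Fin (F.P (recordK₀ F Mc k + n)).d) (y : Site (F.P (recordK₀ F Mc k + n)) (k + 1)),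
      letI Hr : PBond (F.P (recordK₀ F Mc k + n)) 0 → Fin 2 → Fin 2 → ℂ := fun b' => recordHrLocξ F θ k (recordK₀ F Mc k + n) Finset.univ a (μ, y) b';
      ∀ b : PBond (F.P (recordK₀ F Mc k + n)) 0,
        ‖∑ ν : Fin (F.P (recordK₀ F Mc k + n)).d, (Hr ⟨b.src.shift ν, b.dir⟩ - (2 : ℂ) • Hr b + Hr ⟨b.src.unshift ν, b.dir⟩)‖ ≤
          C₉' * (F.P (recordK₀ F Mc k + n)).eta (k + 1) ^ 3 * Real.exp (-(δ₉ * (Site.tdist (coarsenTo (k + 1) b.src) y : ℝ))) := by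
  obtain ⟨C₃, δ₃, hC₃, hδ₃, h3⟩ := norm_recordHrLocξ_univ_lapStencil_le F
  exact ⟨C₃, δ₃, hC₃, hδ₃, fun k n ε₂₉ _ a μ y b => h3 a₀ ε₂₉ (recordK₀ F Mc k + n) k (hk2_recordK₀ F Mc k n) a μ y b⟩

/-! ## §4  ★★★ The selector-free U8 package with all four (‴-LocUniv) clauses discharged -/

/-- ★★★ **THE SELECTOR-FREE U8 PACKAGE ON THE TRANSVERSE TABLE, ALL FOUR CLAUSES OF (‴-LocUniv) DISCHARGED**: under the displayed (Tok-cmpU-cap) ONLY (the window-vs-whole-torus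
comparison of `recordHrLocξ`, four clauses at rate `e^{−δ₉(R0−R3)}` inside the inner window), the conclusion of ✓`portPieceLocalityU8_LocUniv` verbatim — (C1)ᵀ `Response9DAtLocUnivξ`
for every colour, (C2a)(C2b)ᵀ and (E4a)ᵀ for `recordEmbLocξ … Finset.univ`.  Clause 3 is §3; clauses 1, 2, 4 are ✓`portPieceLocalityU8_LocUniv_of_clause3`'s own discharges.
[cite: Balaban1985Variational, Prop. 9 p.309, (190) p.308; Balaban1987RG1, (1.21) p.264, (4.4)–(4.5) pp.281–282, (4.35) p.290; Balaban1984PropagatorsI, (1.63) p.30, Prop. 1.2 p.35; Balaban1984PropagatorsII, (2.35) p.228, (2.130) p.246, (2.148)-(2.150) p.249] -/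
theorem portPieceLocalityU8_LocUniv_of_cmp (Mc : ℕ) (a₀ : ℝ) (hMc : McGuard F Mc)
    (hcmp : ∃ C₉' δ₉ : ℝ, 0 ≤ C₉' ∧ 0 < δ₉ ∧ ∀ (k n : ℕ) (ε₂₉ : ℝ), 0 < ε₂₉ → letI θ := thetaFill F a₀ ε₂₉; letI := θ.instVβ₁; letI := θ.instVβ₂; letI := θ.instιβ;
      ∀ (a : θ.ιβ) (μ : Fin (F.P (recordK₀ F Mc k + n)).d) (y : Site (F.P (recordK₀ F Mc k + n)) (k + 1)),
      ∀ R3 R0 : ℕ, R3 + nestRadius Mc 1 ≤ R0 → 2 * (R0 + 1) < (F.P (recordK₀ F Mc k + n)).sitesPerDir (k + 1) → ∀ z₀ : Fin 4 → ℤ, y ∈ recordWindow F k (recordK₀ F Mc k + n) R3 z₀ →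
      letI Hd : PBond (F.P (recordK₀ F Mc k + n)) 0 → Fin 2 → Fin 2 → ℂ := fun b' => recordHrLocξ F θ k (recordK₀ F Mc k + n) Finset.univ a (μ, y) b' -
        recordHrLocξ F θ k (recordK₀ F Mc k + n) (recordWindow F k (recordK₀ F Mc k + n) R0 z₀) a (μ, y) b';
      ∀ b : PBond (F.P (recordK₀ F Mc k + n)) 0, coarsenTo (k + 1) b.src ∈ recordWindow F k (recordK₀ F Mc k + n) R3 z₀ →
        ‖Hd b‖ ≤ C₉' * (F.P (recordK₀ F Mc k + n)).eta (k + 1) * Real.exp (-(δ₉ * ((R0 : ℝ) - (R3 : ℝ)))) ∧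
        (∀ ν : Fin (F.P (recordK₀ F Mc k + n)).d, ‖Hd ⟨b.src.shift ν, b.dir⟩ - Hd b‖ ≤ C₉' * (F.P (recordK₀ F Mc k + n)).eta (k + 1) ^ 2 * Real.exp (-(δ₉ * ((R0 : ℝ) - (R3 : ℝ))))) ∧
        ‖∑ ν : Fin (F.P (recordK₀ F Mc k + n)).d, (Hd ⟨b.src.shift ν, b.dir⟩ - (2 : ℂ) • Hd b + Hd ⟨b.src.unshift ν, b.dir⟩)‖ ≤
          C₉' * (F.P (recordK₀ F Mc k + n)).eta (k + 1) ^ 3 * Real.exp (-(δ₉ * ((R0 : ℝ) - (R3 : ℝ)))) ∧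
        ‖∑ ν : Fin (F.P (recordK₀ F Mc k + n)).d, ((Hd ⟨b.src, b.dir⟩ + Hd ⟨(b.src).shift b.dir, ν⟩ - Hd ⟨(b.src).shift ν, b.dir⟩ - Hd ⟨b.src, ν⟩) -
          (Hd ⟨b.src.unshift ν, b.dir⟩ + Hd ⟨(b.src.unshift ν).shift b.dir, ν⟩ - Hd ⟨(b.src.unshift ν).shift ν, b.dir⟩ - Hd ⟨b.src.unshift ν, ν⟩))‖ ≤
          C₉' * (F.P (recordK₀ F Mc k + n)).eta (k + 1) ^ 3 * Real.exp (-(δ₉ * ((R0 : ℝ) - (R3 : ℝ)))))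
    (α₂ : ℝ) (hα₂ : 0 < α₂) :
    ∃ C₉ δ₀ : ℝ, 0 ≤ C₉ ∧ 0 < δ₀ ∧ ∀ k : ℕ, ∀ ε₂₉ : ℝ, 0 < ε₂₉ →
      (∀ a : (thetaFill F a₀ ε₂₉).ιβ, Response9DAtLocUnivξ F (thetaFill F a₀ ε₂₉) a Mc k (recordK₀ F Mc k) α₂ C₉ δ₀) ∧
      ∀ n : ℕ, letI θ := thetaFill F a₀ ε₂₉; letI := θ.instVβ₁; letI := θ.instVβ₂;
        (ContDiffAt ℝ 2 (recordEmbLocξ F θ k (recordK₀ F Mc k + n) Finset.univ) 0 ∧ recordEmbLocξ F θ k (recordK₀ F Mc k + n) Finset.univ 0 = 0) ∧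
        ∀ a : θ.ιβ, ResponseRowAtLocξ F θ k (recordK₀ F Mc k + n) Finset.univ a :=
  portPieceLocalityU8_LocUniv_of_clause3 F Mc a₀ hMc (h3_recordHrLocξ_univ F Mc a₀) hcmp α₂ hα₂

end Summit.QuantumFields.YangMills.Theorems.PortU8

end
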